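import Summits.RiemannHypothesis.RiemannHypothesis.Theses.NymanBeurling
import Summits.RiemannHypothesis.RiemannHypothesis.Theorems.NymanBeurlingNbThesis

/-!
# RiemannHypothesis / NymanBeurling — the assembly `Assembly` (thesis ⇒ RH)

Route `RiemannHypothesis/NymanBeurling`, item stmt-RiemannHypothesis-0393 (`Assembly`, rank 1):

  `(∀ ε > 0, ∃ N a, ∫⁻ |1 - ζ(1/2+it) Σ_{k<N} a_k (k+1)^{-(1/2+it)}|² dt/(1/4+t²) < ε) → RH`,

the elementary half of the Nyman–Beurling–Báez-Duarte criterion in its Dirichlet-polynomial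
(`d_N`) form: if the Báez-Duarte distances tend to `0`, the Riemann Hypothesis holds.

The hypothesis of `Assembly` is, verbatim, the route's thesis `NbThesis`, and
`NbThesis → Summit.RiemannHypothesis` is the accepted theorem
`Summit.RiemannHypothesis.RiemannHypothesis.Theorems.assembly_holds'`
(file `Theorems/NymanBeurlingNbThesis.lean`), itself the `mp` direction of the kernel-checked
calibration `nbThesis_iff : NbThesis ↔ Summit.RiemannHypothesis`, whose elementary half is
`Literature.NumberTheory.LFunctions.riemannHypothesis_of_dirichlet_approx` (a zero `ρ` of `ζ` with
`Re ρ > 1/2` yields the bounded Mellin point-evaluation functional at `ρ`, which kills every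
`ζ(s)A(s)/s` but not `1/s = M[χ_(0,1)](s)`; zeros with `Re ρ < 1/2` are excluded by the functional
equation). So the assembly closes by that theorem.

References: B. Nyman, Thesis, Uppsala (1950); A. Beurling, Proc. Nat. Acad. Sci. 41 (1955)
312–314; L. Báez-Duarte, Rend. Lincei (9) 14 (2003) 5–11, Thm. 1.1 (if part).
-/

namespace Summit.RiemannHypothesis.RiemannHypothesis.Theorems

open Summit.RiemannHypothesis.RiemannHypothesis.Theses.NymanBeurling

/-- **Assembly of route NymanBeurling** (item stmt-RiemannHypothesis-0393): if for every `ε > 0`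
some Dirichlet polynomial `A(s) = Σ_{k<N} a_k (k+1)^{-s}` achieves
`∫⁻ |1 - ζ(1/2+it) A(1/2+it)|² dt/(1/4+t²) < ε`, then the Riemann Hypothesis holds — the
elementary half of the Nyman–Beurling–Báez-Duarte criterion. The hypothesis is literally the
route thesis `NbThesis`, so this is `assembly_holds' : NbThesis → Summit.RiemannHypothesis`.
[BaezDuarte2003, Thm. 1.1 (if part); Beurling1955] -/
theorem nbAssembly_proof : Assembly := by
  unfold Assembly
  exact assembly_holds'

end Summit.RiemannHypothesis.RiemannHypothesis.Theorems
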